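import Literature.MathematicalPhysics.QuantumLattice.LatticeGaugeDLRGibbsProofs
import HarnessLib

/-!
# Charts of `ℤ⁴` into a finite volume: Wilson-action splitting (abstract bookkeeping)

Helper file for stub `stub_tubeLimitState` of crux `FibreToTorus` (stmt-QuantumFields-16244),
line `uniqueness`, route `ContractibleFibre`.  A finite volume with site type `St`, nearest-
neighbour structure `sh : St → Fin 4 → St` (the forward neighbour in each direction), plaquette
switch `ins` and a chart `ψ : Site 4 → St` which, on a finite set `B` of sites of `ℤ⁴`, is
injective, intertwines the unit steps (`ψ (x + eμ) = sh (ψ x) μ`), has unique predecessors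
(`sh z μ = ψ x → z = ψ (x - eμ)`) and switches all plaquettes on (`ins (ψ x) = 1`).  For such a
chart and a finite edge set `Λ` with `Λ ∪ S₀ ∪ ∂Λ` based in `B`, the Wilson-type action
`β Σ_z Σ_{μ<κ} ins · Re tr ρ(V_{z,μκ})` of the finite volume splits as
`-β S_Λ(V ∘ π) + c + b(V)` with `b` blind to the edges `π(Λ)` (`π = ψ × id` on edges) — the
hypotheses of the charted local DLR identity `integral_weight_comp_chart_eq_condAvg`.  The free
tubes `(ℤ/L)² × Fin(M+1)²` of the crux are the instance (file `…TubeChart`).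
-/

noncomputable section

open MeasureTheory Filter Topology Finset
open Literature.Probability.LatticeModels
open Literature.MathematicalPhysics.QuantumLattice

namespace Summit.QuantumFields.YangMills.Theorems.FibreToTorus

variable {N : ℕ} {G : Type*} [Group G] {St : Type*} (sh : St → Fin 4 → St) (ψ : Site 4 → St)
  (B : Finset (Site 4))

/-- The chart on edges, `π (x, i) = (ψ x, i)`, is injective on every edge set based in `B` when
`ψ` is injective on `B`. [folklore] -/
theorem injOn_edgeChart (hinjψ : Set.InjOn ψ ↑B) {T : Finset (ZdEdge 4)}
    (hT : T.image Prod.fst ⊆ B) :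
    Set.InjOn (fun e : ZdEdge 4 => (ψ e.1, e.2)) ↑T := by
  intro e₁ h₁ e₂ h₂ h
  simp only [Prod.mk.injEq] at h
  refine Prod.ext (hinjψ ?_ ?_ h.1) h.2
  · exact hT (mem_image_of_mem _ (mem_coe.1 h₁))
  · exact hT (mem_image_of_mem _ (mem_coe.1 h₂))

/-- Plaquette charting `p ↦ (ψ p.1, p.2)` is injective on the plaquettes touching `Λ` once their
base points lie in `B`. [folklore] -/
theorem injOn_plaquetteChart (hinjψ : Set.InjOn ψ ↑B) {Λ : Finset (ZdEdge 4)}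
    (hΛ : ((plaquettesTouching Λ).biUnion plaquetteEdges).image Prod.fst ⊆ B) :
    Set.InjOn (fun p : ZdPlaquette 4 => (ψ p.1, p.2)) ↑(plaquettesTouching Λ) := by
  intro p₁ h₁ p₂ h₂ h
  simp only [Prod.mk.injEq] at h
  refine Prod.ext (hinjψ ?_ ?_ h.1) h.2
  · exact hΛ (fst_mem_image_of_mem_plaquettesTouching h₁)
  · exact hΛ (fst_mem_image_of_mem_plaquettesTouching h₂)

/-- **Holonomies through the chart.** If `ψ` intertwines the unit steps at `x`, the finite-volume
holonomy at `ψ x` of `V` is the `ℤ⁴` holonomy at `x` of `V ∘ π`. [folklore] -/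
theorem chartHolonomy_eq (V : St × Fin 4 → G) {x : Site 4}
    (hstep : ∀ μ : Fin 4, ψ (x + Pi.single μ 1) = sh (ψ x) μ) (μ κ : Fin 4) :
    V (ψ x, μ) * V (sh (ψ x) μ, κ) * (V (sh (ψ x) κ, μ))⁻¹ * (V (ψ x, κ))⁻¹ =
      plaquetteHolonomyZd (V ∘ fun e : ZdEdge 4 => (ψ e.1, e.2)) x μ κ := by
  simp only [plaquetteHolonomyZd, Function.comp_apply, hstep]

/-- **Edges of `π(Λ)` belong to charted touching plaquettes only.** If one of the four edges
`(z, μ), (sh z μ, κ), (sh z κ, μ), (z, κ)` of a finite-volume plaquette is the chart image of an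
edge `e ∈ Λ` based at a point with unique predecessors, then the plaquette is the chart image of
a plaquette of `ℤ⁴` touching `Λ`. [folklore] -/
theorem exists_touching_of_edgeChart_eq {Λ : Finset (ZdEdge 4)}
    (hpred : ∀ x ∈ Λ.image Prod.fst, ∀ (μ : Fin 4) (z : St), sh z μ = ψ x →
      z = ψ (x - Pi.single μ 1))
    {e : ZdEdge 4} (he : e ∈ Λ) (z : St) (q : {q : Fin 4 × Fin 4 // q.1 < q.2})
    (hq : (ψ e.1, e.2) = (z, q.1.1) ∨ (ψ e.1, e.2) = (sh z q.1.1, q.1.2) ∨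
      (ψ e.1, e.2) = (sh z q.1.2, q.1.1) ∨ (ψ e.1, e.2) = (z, q.1.2)) :
    ∃ p ∈ plaquettesTouching Λ, (ψ p.1, p.2) = (z, q) := by
  obtain ⟨x, k⟩ := e
  have hx : x ∈ Λ.image Prod.fst := mem_image.2 ⟨(x, k), he, rfl⟩
  simp only [Prod.mk.injEq] at hq
  rcases hq with ⟨h1, h2⟩ | ⟨h1, h2⟩ | ⟨h1, h2⟩ | ⟨h1, h2⟩
  · refine ⟨(x, q), mem_plaquettesTouching_iff.2 ⟨(x, k), mem_inter.2 ⟨?_, he⟩⟩, ?_⟩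
    · simp [plaquetteEdges, h2]
    · simp [h1]
  · have hz : z = ψ (x - Pi.single q.1.1 1) := hpred x hx q.1.1 z h1.symm
    refine ⟨(x - Pi.single q.1.1 1, q),
      mem_plaquettesTouching_iff.2 ⟨(x, k), mem_inter.2 ⟨?_, he⟩⟩, ?_⟩
    · simp [plaquetteEdges, h2]
    · simp [hz]
  · have hz : z = ψ (x - Pi.single q.1.2 1) := hpred x hx q.1.2 z h1.symm
    refine ⟨(x - Pi.single q.1.2 1, q),
      mem_plaquettesTouching_iff.2 ⟨(x, k), mem_inter.2 ⟨?_, he⟩⟩, ?_⟩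
    · simp [plaquetteEdges, h2]
    · simp [hz]
  · refine ⟨(x, q), mem_plaquettesTouching_iff.2 ⟨(x, k), mem_inter.2 ⟨?_, he⟩⟩, ?_⟩
    · simp [plaquetteEdges, h2]
    · simp [h1]

variable [Fintype St] [DecidableEq St] (ins : St → Fin 4 → Fin 4 → ℝ)
  (ρ : G →* Matrix (Fin N) (Fin N) ℂ) [TopologicalSpace G] [IsTopologicalGroup G]

/-- **Wilson-action splitting through a good chart.** Let the chart `ψ` be injective on `B`,
intertwine the unit steps and have unique predecessors at the points of `B`, and switch on all
plaquettes based in `ψ(B)`; let `Λ ∪ S₀ ∪ ∂Λ` be based in `B`.  Then the edge chart `π` is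
injective on `Λ ∪ S₀ ∪ ∂Λ`, and the finite-volume Wilson-type action
`β Σ_z Σ_{μ<κ} ins(z,μ,κ) Re tr ρ(V_{z,μκ})` equals `a V + b V` with
`a V = -β S_Λ(V ∘ π) + β N #{plaquettes touching Λ}` (the charted images of the touching
plaquettes) and `b` (all other plaquettes) continuous and invariant under resampling the edges in
`Λ.image π`. [folklore] -/
theorem chart_action_split (hρ : Continuous ρ) (β : ℝ) (hinjψ : Set.InjOn ψ ↑B)
    (hstep : ∀ x ∈ B, ∀ μ : Fin 4, ψ (x + Pi.single μ 1) = sh (ψ x) μ)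
    (hpred : ∀ x ∈ B, ∀ (μ : Fin 4) (z : St), sh z μ = ψ x → z = ψ (x - Pi.single μ 1))
    (hins : ∀ x ∈ B, ∀ μ κ : Fin 4, ins (ψ x) μ κ = 1) (Λ S₀ : Finset (ZdEdge 4))
    (hB : (Λ ∪ S₀ ∪ (plaquettesTouching Λ).biUnion plaquetteEdges).image Prod.fst ⊆ B) :
    Set.InjOn (fun e : ZdEdge 4 => (ψ e.1, e.2))
        ↑(Λ ∪ S₀ ∪ (plaquettesTouching Λ).biUnion plaquetteEdges) ∧
      ∃ (a b : (St × Fin 4 → G) → ℝ) (c : ℝ), Continuous a ∧ Continuous b ∧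
        (∀ V, a V = -β * wilsonBoundaryAction ρ Λ (V ∘ fun e : ZdEdge 4 => (ψ e.1, e.2)) + c) ∧
        (∀ W V, b ((Λ.image fun e : ZdEdge 4 => (ψ e.1, e.2)).piecewise W V) = b V) ∧
        ∀ V, β * ∑ z : St, ∑ q : {q : Fin 4 × Fin 4 // q.1 < q.2}, ins z q.1.1 q.1.2 *
            (ρ (V (z, q.1.1) * V (sh z q.1.1, q.1.2) * (V (sh z q.1.2, q.1.1))⁻¹ *
              (V (z, q.1.2))⁻¹)).trace.re = a V + b V := by
  classical
  -- bookkeeping of base points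
  have hΛB : Λ.image Prod.fst ⊆ B := fun x hx => by
    obtain ⟨e, he, rfl⟩ := mem_image.1 hx
    exact hB (mem_image_of_mem _ (mem_union_left _ (mem_union_left _ he)))
  have hPB : ((plaquettesTouching Λ).biUnion plaquetteEdges).image Prod.fst ⊆ B := fun x hx => by
    obtain ⟨e, he, rfl⟩ := mem_image.1 hx
    exact hB (mem_image_of_mem _ (mem_union_right _ he))
  have hinjπ := injOn_edgeChart ψ B hinjψ hB
  have hinjP := injOn_plaquetteChart ψ B hinjψ hPB
  refine ⟨hinjπ, ?_⟩
  -- the plaquette term and the image set of the touching plaquettes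
  set f : (St × Fin 4 → G) → St × {q : Fin 4 × Fin 4 // q.1 < q.2} → ℝ := fun V zq =>
    ins zq.1 zq.2.1.1 zq.2.1.2 * (ρ (V (zq.1, zq.2.1.1) * V (sh zq.1 zq.2.1.1, zq.2.1.2) *
      (V (sh zq.1 zq.2.1.2, zq.2.1.1))⁻¹ * (V (zq.1, zq.2.1.2))⁻¹)).trace.re with hf_def
  set Im : Finset (St × {q : Fin 4 × Fin 4 // q.1 < q.2}) :=
    (plaquettesTouching Λ).image fun p : ZdPlaquette 4 => (ψ p.1, p.2) with hIm_def
  have hfc : ∀ zq, Continuous fun V : St × Fin 4 → G => f V zq := fun zq => by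
    simp only [hf_def]
    refine continuous_const.mul (Complex.continuous_re.comp (Continuous.matrix_trace (hρ.comp ?_)))
    fun_prop
  refine ⟨fun V => β * ∑ zq ∈ Im, f V zq, fun V => β * ∑ zq ∈ Imᶜ, f V zq,
    β * ((N : ℝ) * (plaquettesTouching Λ).card), ?_, ?_, ?_, ?_, ?_⟩
  · exact continuous_const.mul (continuous_finsetSum _ fun zq _ => hfc zq)
  · exact continuous_const.mul (continuous_finsetSum _ fun zq _ => hfc zq)
  · -- near part: the charted touching plaquettes give the boundary Wilson action
    intro V
    beta_reduce
    have hnear : ∑ zq ∈ Im, f V zq = ∑ p ∈ plaquettesTouching Λ,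
        plaquetteObs ρ p.1 p.2.1.1 p.2.1.2 (V ∘ fun e : ZdEdge 4 => (ψ e.1, e.2)) := by
      rw [hIm_def, sum_image hinjP]
      refine sum_congr rfl fun p hp => ?_
      have hpB : p.1 ∈ B := hPB (fst_mem_image_of_mem_plaquettesTouching hp)
      simp only [hf_def, hins p.1 hpB, one_mul, plaquetteObs,
        chartHolonomy_eq sh ψ V (hstep p.1 hpB)]
    have hS : wilsonBoundaryAction ρ Λ (V ∘ fun e : ZdEdge 4 => (ψ e.1, e.2)) =
        (N : ℝ) * (plaquettesTouching Λ).card - ∑ p ∈ plaquettesTouching Λ,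
          plaquetteObs ρ p.1 p.2.1.1 p.2.1.2 (V ∘ fun e : ZdEdge 4 => (ψ e.1, e.2)) := by
      rw [wilsonBoundaryAction, sum_sub_distrib, sum_const, nsmul_eq_mul, mul_comm]
    rw [hnear, hS]
    ring
  · -- far part: plaquettes outside the image do not see the edges `π(Λ)`
    intro W V
    beta_reduce
    refine congrArg (fun t => β * t) (sum_congr rfl fun zq hzq => ?_)
    have hzq : zq ∉ Im := (mem_compl.1 hzq)
    have key : ∀ e' : St × Fin 4,
        (e' = (zq.1, zq.2.1.1) ∨ e' = (sh zq.1 zq.2.1.1, zq.2.1.2) ∨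
          e' = (sh zq.1 zq.2.1.2, zq.2.1.1) ∨ e' = (zq.1, zq.2.1.2)) →
        (Λ.image fun e : ZdEdge 4 => (ψ e.1, e.2)).piecewise W V e' = V e' := fun e' h' =>
      piecewise_eq_of_notMem _ _ _ fun hmem => by
        obtain ⟨e, he, rfl⟩ := mem_image.1 hmem
        obtain ⟨p, hp, hpq⟩ := exists_touching_of_edgeChart_eq sh ψ
          (fun x hx μ z h => hpred x (hΛB hx) μ z h) he zq.1 zq.2 h'
        exact hzq (hIm_def ▸ mem_image.2 ⟨p, hp, hpq.trans (Prod.mk.eta)⟩)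
    simp only [hf_def]
    rw [key _ (Or.inl rfl), key _ (Or.inr (Or.inl rfl)), key _ (Or.inr (Or.inr (Or.inl rfl))),
      key _ (Or.inr (Or.inr (Or.inr rfl)))]
  · -- the whole action is near part plus far part
    intro V
    beta_reduce
    have h1 : ∑ z : St, ∑ q : {q : Fin 4 × Fin 4 // q.1 < q.2}, ins z q.1.1 q.1.2 *
        (ρ (V (z, q.1.1) * V (sh z q.1.1, q.1.2) * (V (sh z q.1.2, q.1.1))⁻¹ *
          (V (z, q.1.2))⁻¹)).trace.re = ∑ zq : St × {q : Fin 4 × Fin 4 // q.1 < q.2}, f V zq := by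
      rw [hf_def, ← Fintype.sum_prod_type']
    rw [h1, ← sum_add_sum_compl Im (f V), mul_add]

/-- **Registered form (sub-goal `tubeLimit_chartSplit` of `stub_tubeLimitState`)** of
`chart_action_split`: closed statement. [folklore] -/
theorem tubeLimit_chartSplit : ∀ (N : ℕ) (G : Type) [Group G] [TopologicalSpace G] [IsTopologicalGroup G] (St : Type) [Fintype St] [DecidableEq St] (sh : St → Fin 4 → St) (ψ : Site 4 → St) (B : Finset (Site 4)) (ins : St → Fin 4 → Fin 4 → ℝ) (ρ : G →* Matrix (Fin N) (Fin N) ℂ), Continuous ρ → ∀ β : ℝ, Set.InjOn ψ ↑B → (∀ x ∈ B, ∀ μ : Fin 4, ψ (x + Pi.single μ 1) = sh (ψ x) μ) → (∀ x ∈ B, ∀ (μ : Fin 4) (z : St), sh z μ = ψ x → z = ψ (x - Pi.single μ 1)) → (∀ x ∈ B, ∀ μ κ : Fin 4, ins (ψ x) μ κ = 1) → ∀ (Λ S₀ : Finset (ZdEdge 4)), (Λ ∪ S₀ ∪ (plaquettesTouching Λ).biUnion plaquetteEdges).image Prod.fst ⊆ B → Set.InjOn (fun e : ZdEdge 4 =>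 (ψ e.1, e.2)) ↑(Λ ∪ S₀ ∪ (plaquettesTouching Λ).biUnion plaquetteEdges) ∧ ∃ (a b : (St × Fin 4 → G) → ℝ) (c : ℝ), Continuous a ∧ Continuous b ∧ (∀ V, a V = -β * wilsonBoundaryAction ρ Λ (V ∘ fun e : ZdEdge 4 => (ψ e.1, e.2)) + c) ∧ (∀ W V, b ((Λ.image fun e : ZdEdge 4 => (ψ e.1, e.2)).piecewise W V) = b V) ∧ ∀ V, β * ∑ z : St, ∑ q : {q : Fin 4 × Fin 4 // q.1 < q.2}, ins z q.1.1 q.1.2 * (ρ (V (z, q.1.1) * V (sh z q.1.1, q.1.2) * (V (sh z q.1.2, q.1.1))⁻¹ * (V (z, q.1.2))⁻¹)).trace.re = a V + b V :=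
  fun _ _ _ _ _ _ _ _ sh ψ B ins ρ hρ β hinjψ hstep hpred hins Λ S₀ hB =>
    chart_action_split sh ψ B ins ρ hρ β hinjψ hstep hpred hins Λ S₀ hB

end Summit.QuantumFields.YangMills.Theorems.FibreToTorus

end
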